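/-
Copyright (c) 2026 the pub-hodgecm-mathlib formalisation cell (harness21).  Prover seat hodgecm-mathlib-LH4-p06 (g9), req620 Track A «(D-RAM) FOUR-FRAME» squad
F0∕P3c∕LH4; the (β₂) road (R-36) «PURE-CELL LEDGER», β₂ WORD #27 (a)∕#28 (a) of the sub-dealer LH4-p04 (g10): piece ‹D0›, file D0-2 = the `g = 0` twin of ★ K7c-A
`F0P3cDyRamDiagonalCellVertexRead` of LH4-p19 (g2); helper lane on h413 = stmt-HodgeConjecture-24833 (count-neutral).  2026-09-05.
-/
import Summits.HodgeConjecture.HodgeConjecture.Theorems.F0P3cDyRamDiagonalCellVertexRead        -- ★ K7c-A (LH4-p19 (g2)): `v_hatmu_letters_of_row`; brings ★ p863048, ★ K5c `coords_letters_of_gen`, ★ K3, ★ `labelPlus_smul_xPlus_iff_exists_norm`, BRIDGE-AC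
import Summits.HodgeConjecture.HodgeConjecture.Theorems.F0P3cDyRamDiagonalCellLetterBalanced     -- ★ (LH4-p19): `valueSet_endoGL_sub_one_glued_eq_scalar_normSet_of_diag` (gap-free); brings ★ `…DiagonalCellLetter` `v_add_map_le_varpi_pow_mstar_of_datum`
import Summits.HodgeConjecture.HodgeConjecture.Theorems.F0P3cDyRamDiagonalCellCleanRegime       -- ★ p861813: `refSkew_map_and_v` (`|t₊| = 1`, `d` even)
import HarnessLib

/-!
# Crux `H413`, line LH4 «(D-RAM) FOUR-FRAME» — STAGE-1b, row (2), the (β₂) road (R-36), lane B, piece ‹D0› (β₂ WORD #24∕#27∕#28), file D0-2: «THE PER-VERTEX LABEL READ OF THE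
# DIAGONAL CELL AT THE EIGENVALUE GAP δ = 0» — off the X-digit `LAB ↔ ω(T̂)·ω(α₁ + γ₁V̂) = 1` (★ K7c-A's read with `g = 0`), on the X-digit `¬ LAB`

Cell `hodgecm-mathlib` (D-0151), FLOOR 0, crux item H413 = `stmt-HodgeConjecture-24833`, route of record `HCCMUnconditional`; squad F0∕P3c∕LH4; lane
`--supports stmt-HodgeConjecture-24833 --as helper` (count-neutral; pays NO tier-0 row).  THEOREMS ONLY (no `def`, no instance, no notation, no `sorry`, default heartbeats);
★-only imports; states NO law; (β₂) stays a HYPOTHESIS.  Letters = ★ K7c-A `valueSet_eq_xPlus_iff_affineSign`'s glued-vertex frame on the DIAGONAL cell VERBATIM (plane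
`(H₂, h_W)`, `Γ = endoGL (γ₂, u)`, line model `jE ρ Θ α φ lam h`, a vertex `L` glued over `(B₂, w₀, g₀)` presenting `Λ = x₀·𝒪_b`, `|Y| = |jEϖ|^b`, `|μ| = |jEϖ|^{2b}`, the
pivot `θ₀`, the coordinates `â b̂` of `μ̂`, the preimages `T̂ V̂`), with the gap letters changed to `g = 0`: `|μ − ρμ| = |jEϖ|^{2b}` (i.e. `jl = m` on the live row), `m* ≤ b`, deep
tokens at `3d − 2 + d%2 ≤ n ≤ 2b`; the affine letters `α₁ γ₁` enter through the three clauses of ★ D0-1 `exists_affineLabel_of_coords_of_gap_zero` as HYPOTHESES (`haff`: the read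
off the X-digit; `hunit`: unit scalar off it; `hdrop`: non-unit scalar on it).

WHY (LH4-p15 (g2) 2026-09-05 00:31:41Z (c); this seat's SIG 01:04Z, β₂ WORD #28 (a) «=»).  ★ K7c-A reads the label of a diagonal-cell vertex through ★ p863048 (a `σ`-fixed unit `e′`
near the ray scalar `e₀ = T̂(â + b̂V̂)`, `jE e₀ = Tr_ρ(μ∕D₀)`, ★ K3) — its only uses of `1 ≤ g` are the sizes `|â| = 1 > |b̂V̂|` giving `|e₀| = 1`, and the levels `m* ≤ b + 2g`,
`n ≤ 2b + 2g` of the ray-domination ∕ skew tokens.  At `g = 0` (`|B̂| = 1 ≥ |Â|`, ★ D0-1) the scalar `e₀` is a unit exactly OFF the X-digit `|α₁ + γ₁V̂| < 1`; there §1 repeats ★ K7c-A's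
proof with `m* ≤ b`, `n ≤ 2b` (a floor `m ≥ 6` at `d = 2`); ON the X-digit `|e₀| < 1`, and the gap-free letter ★ `valueSet_endoGL_sub_one_glued_eq_scalar_normSet_of_diag`
(`VS_{m*}(L) = thick_{m*}{e₀·N(a)}`) misses `t₊ ∈ valueSetMod σ ϖ m* X₊`: the vertex is NOT labelled `+` (§2).
* §1 HEAD `valueSet_eq_xPlus_iff_affineSign_of_gap_zero` — off the X-digit: `VS_{m*}(Γ − 1 ∣ L) = valueSetMod σ ϖ m* X₊ ↔ normSign σ T̂ * normSign σ (α₁ + γ₁V̂) = 1`.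
* §2 `valueSet_ne_xPlus_of_xDigit_of_gap_zero` — on the X-digit: `VS_{m*}(Γ − 1 ∣ L) ≠ valueSetMod σ ϖ m* X₊` (letters: a sub-frame + `|u₀₀ − 1| ≤ |ϖ^{m*}|`, `d ≤ b`, the RamK
  datum `IsRamifiedQuadraticDatum Θ (jE ϖ) d t_M` for the trace letter ★ `v_add_map_le_varpi_pow_mstar_of_datum`).
WHAT IS NOT CLAIMED: the shells at δ = 0 (socket ‹Z-SH›), the digit count (‹Z-CNT›), the existence of glued vertices, any cell law.
HONEST LABEL.  Count-neutral per-vertex bookkeeping; nothing printed is asserted; ‹D0› OPEN; `HC_CM` is proved only modulo the 7 printed citations (2 remaining named inputs: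
hLiu418 = `stmt-HodgeConjecture-24832`, h413 = `stmt-HodgeConjecture-24833`) until rung 0 closes.
## References
* [Jacobowitz1962] R. Jacobowitz, *Hermitian forms over local fields*, Amer. J. Math. 84 (1962): §4 (dual lattices, norm-residue gluing).
* [Rogawski1990] J. D. Rogawski, *Automorphic Representations of Unitary Groups in Three Variables*, Ann. of Math. Stud. 123 (1990): §4.9 Prop. 4.9.1 (b) p. 55.
* [Kottwitz1986BaseChangeUnits] R. E. Kottwitz, *Base change for unit elements of Hecke algebras*, Compositio Math. 60 (1986): §1 pp. 240–241.
* [Serre1979] J.-P. Serre, *Local Fields*, GTM 67 (1979): Ch. I §6 Prop. 18; Ch. III §3 Prop. 7; Ch. V §2 Prop. 3, §3 Cor. 3 pp. 85–87.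
* [LanglandsShelstad1987] R. P. Langlands, D. Shelstad, *On the definition of transfer factors*, Math. Ann. 278 (1987): §1–§3.
-/

set_option autoImplicit false

noncomputable section

namespace Summit.HodgeConjecture.HodgeConjecture.Cruxes.H413.F0P3cDyRamDiagonalCellVertexReadDeltaZero

open scoped Valued WithZero Matrix MatrixGroups
open WithZero
open Literature.NumberTheory.Automorphic Literature.NumberTheory.Automorphic.HermitianLattice Literature.NumberTheory.Automorphic.UnitaryLatticeTree
open Literature.NumberTheory.Automorphic.UnitaryThreeFourFrame (IsRamifiedQuadraticDatum normSign normSign_of_isNorm normSign_of_not_isNorm)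
open Literature.NumberTheory.Rogawski1990
open Literature.NumberTheory.LocalFields (isAdicComplete_valuedInteger_of_completeSpace)
open Summit.HodgeConjecture.HodgeConjecture.Cruxes.H413.F0P3cDyRamFourFramePieces
open Summit.HodgeConjecture.HodgeConjecture.Cruxes.H413.F0P3cDyRamToricCensusDefs
open Summit.HodgeConjecture.HodgeConjecture.Cruxes.H413.F0P3cDyRamRayScalarNearlyFixed (exists_fixed_unit_valueSet_endoGL_sub_one_glued_eq_smul_xPlus)
open Summit.HodgeConjecture.HodgeConjecture.Cruxes.H413.F0P3cDyRamSmulXPlusLabel (labelPlus_smul_xPlus_iff_exists_norm)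
open Summit.HodgeConjecture.HodgeConjecture.Cruxes.H413.F0P3cDyRamDiagonalCellCoordinates (trace_scalar_eq_coords)
open Summit.HodgeConjecture.HodgeConjecture.Cruxes.H413.F0P3cDyRamDiagonalCellGeneratorIndependence (coords_letters_of_gen)
open Summit.HodgeConjecture.HodgeConjecture.Cruxes.H413.F0P3cDyRamSmulXPlusLabel (valueSetMod_smul_xPlus)
open Summit.HodgeConjecture.HodgeConjecture.Cruxes.H413.F0P3cDyRamDiagonalCellVertexRead (v_hatmu_letters_of_row)
open Summit.HodgeConjecture.HodgeConjecture.Cruxes.H413.F0P3cDyRamDiagonalCellLetterBalanced (valueSet_endoGL_sub_one_glued_eq_scalar_normSet_of_diag)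
open Summit.HodgeConjecture.HodgeConjecture.Cruxes.H413.F0P3cDyRamDiagonalCellLetter (v_add_map_le_varpi_pow_mstar_of_datum)
open Summit.HodgeConjecture.HodgeConjecture.Cruxes.H413.F0P3cDyRamDiagonalCellCleanRegime (refSkew_map_and_v)

variable {E M : Type} [Field E] [Valued E ℤᵐ⁰] [Field M] [Valued M ℤᵐ⁰] {ρ Θ : M →+* M} {α : M}

/-! ## §1 HEAD — off the X-digit the label is the affine sign (★ K7c-A at `g = 0`) -/

/-- **HEAD — «AT δ = 0, OFF THE X-DIGIT, A GLUED VERTEX OVER `Λ = x₀·𝒪_b` IS LABELLED `+` IFF `ω_σ(T̂)·ω_σ(α₁ + γ₁V̂) = 1`».**  ★ K7c-A's frame VERBATIM with the gap letters at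
`g = 0` (`|μ − ρμ| = |jEϖ|^{2b}`, `m* ≤ b`, `n ≤ 2b`), the affine read `haff` guarded by `|α₁ + γ₁V| = 1`, the unit clause `hunit`, and `hX : |α₁ + γ₁V̂| = 1` (off the X-digit).
Proof = ★ K7c-A's: ray domination and skew (★ `v_hatmu_letters_of_row` at `g = 0`), ★ p863048's nearly-fixed unit `e′`, `haff` at `(T̂, V̂, e′)`, ★ `labelPlus_smul_xPlus_iff_exists_norm`.
[cite: Jacobowitz1962, §4] [cite: Rogawski1990, §4.9 Prop. 4.9.1 (b) p. 55] [cite: Serre1979, Ch. I §6 Prop. 18; Ch. V §3 Cor. 3] [cite: LanglandsShelstad1987, §1–§3] -/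
theorem valueSet_eq_xPlus_iff_affineSign_of_gap_zero [CompleteSpace E] {σ : E →+* E} {ϖ : E} {d t : ℕ} (hD : IsRamifiedQuadraticDatum σ ϖ d t) (hd0 : d % 2 = 0)
    (H₂ : Matrix (Fin 2) (Fin 2) E) (hW : E)
    (jE : E →+* M) (hjv : ∀ c, Valued.v (jE c) ≤ 1 ↔ Valued.v c ≤ 1) (hjfix : ∀ z, ρ z = z ↔ ∃ c, jE c = z) (hjiso : ∀ a, Valued.v (jE a) = Valued.v a)
    (hρρ : ∀ x, ρ (ρ x) = x) (hvρ : ∀ x, Valued.v (ρ x) = Valued.v x) (hα : ρ α ≠ α) (hα1 : Valued.v α ≤ 1)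
    (hintρ : ∀ z : M, Valued.v z ≤ 1 → Valued.v ((z - ρ z) / (α - ρ α)) ≤ 1)
    (hΘΘ : ∀ x, Θ (Θ x) = x) (hΘρ : ∀ x, Θ (ρ x) = ρ (Θ x)) (hvΘ : ∀ x, Valued.v (Θ x) = Valued.v x) (hΘj : ∀ c, Θ (jE c) = jE (σ c))
    (hU : Valued.v (α - ρ α) = 1) (hram : Valued.v (α - Θ α) < 1)
    (φ : (Fin 2 → E) →+ M) (hφs : ∀ (c : E) (x : Fin 2 → E), φ (c • x) = jE c * φ x)
    {γ₂ : GL (Fin 2) E} {lam h : M} (hφγ : ∀ x, φ ((γ₂ : Matrix (Fin 2) (Fin 2) E) *ᵥ x) = lam * φ x) (hh : h ≠ 0) (hΘh : Θ h = h)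
    (hform : ∀ x y, jE (pairing σ H₂ x y) = h * Θ (φ x) * φ y + ρ (h * Θ (φ x) * φ y))
    {L : Submodule 𝒪[E] (Fin 3 → E)} {b : ℕ} (hpr : ∀ x ∈ L, Valued.v (x 1) * Valued.v ϖ ^ b ≤ 1)
    (hintL : ∀ y ∈ L, Valued.v (pairing σ (!![H₂ 0 0, 0, H₂ 0 1; 0, hW, 0; H₂ 1 0, 0, H₂ 1 1] : Matrix (Fin 3) (Fin 3) E) y y) ≤ 1)
    {B₂ : Submodule 𝒪[E] (Fin 2 → E)} {w₀ : Fin 2 → E} {g₀ : Fin 3 → E}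
    (hB : B₂.map ((Matrix.toLin' (!![1, 0; 0, 0; 0, 1] : Matrix (Fin 3) (Fin 2) E)).restrictScalars 𝒪[E]) =
      L ⊓ LinearMap.ker ((LinearMap.proj (1 : Fin 3) : (Fin 3 → E) →ₗ[E] E).restrictScalars 𝒪[E]))
    (hg₀ : g₀ ∈ L) (hg₀1 : Valued.v (g₀ 1) * Valued.v ϖ ^ b = 1) (hprg : g₀ - Pi.single 1 (g₀ 1) = ![w₀ 0, 0, w₀ 1])
    (u : GL (Fin 1) E) {x₀ : M} (hx₀ : x₀ ≠ 0) {Λ : AddSubgroup M} (hBΛ : B₂.toAddSubgroup.map φ = Λ)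
    (hΛx : ∀ x, x ∈ Λ ↔ ∃ ζ, IsOrd ρ α (jE ϖ ^ b) ζ ∧ x = x₀ * ζ) (hw₀Y : φ w₀ = (dualGen ρ Θ α (jE ϖ ^ b) h x₀)⁻¹ * x₀)
    (hYO : IsOrd ρ α (jE ϖ ^ b) (dualGen ρ Θ α (jE ϖ ^ b) h x₀)) (hYprim : ¬ IsOrd ρ α (jE ϖ ^ b) (dualGen ρ Θ α (jE ϖ ^ b) h x₀ / jE ϖ))
    (hYv : Valued.v (dualGen ρ Θ α (jE ϖ ^ b) h x₀) = Valued.v (jE ϖ) ^ b)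
    (hdep : ∀ b', (∀ x ∈ Λ, Valued.v (h * Θ x * b' + ρ (h * Θ x * b')) ≤ 1) → (lam - jE ((u : Matrix (Fin 1) (Fin 1) E) 0 0)) * b' ∈ Λ)
    -- the line structure and the row letters
    (hΘlam : Θ lam * lam = 1) (hvlam : Valued.v lam = 1) (huu : ((u : Matrix (Fin 1) (Fin 1) E) 0 0) * σ ((u : Matrix (Fin 1) (Fin 1) E) 0 0) = 1)
    (hb1 : 1 ≤ b) (hmb : mstarOfRecord d ≤ 2 * b) (hmg : mstarOfRecord d ≤ b)
    (hm : Valued.v (lam - jE ((u : Matrix (Fin 1) (Fin 1) E) 0 0)) = Valued.v (jE ϖ) ^ (2 * b))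
    (hjl : Valued.v ((lam - jE ((u : Matrix (Fin 1) (Fin 1) E) 0 0)) - ρ (lam - jE ((u : Matrix (Fin 1) (Fin 1) E) 0 0))) = Valued.v (jE ϖ) ^ (2 * b))
    {n : ℕ} (hn : 3 * d - 2 + d % 2 ≤ n) (hn' : n ≤ 2 * b)
    (hlamn : Valued.v (lam - 1) ≤ Valued.v (jE ϖ) ^ n) (hun : Valued.v ((u : Matrix (Fin 1) (Fin 1) E) 0 0 - 1) ≤ Valued.v ϖ ^ n)
    -- the pivot, the coordinates of `μ̂`, the affine letters, the preimages of `T(x₀)`, `V(x₀)`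
    {θ₀ : M} (hΘθ₀ : Θ θ₀ = θ₀) (hθ1 : Valued.v θ₀ ≤ 1) (hθρ : Valued.v (θ₀ - ρ θ₀) = 1)
    {â bh : E}
    (hâ : jE â = (lam - jE ((u : Matrix (Fin 1) (Fin 1) E) 0 0)) / (jE ϖ * Θ (jE ϖ)) ^ b -
      ((lam - jE ((u : Matrix (Fin 1) (Fin 1) E) 0 0)) / (jE ϖ * Θ (jE ϖ)) ^ b - ρ ((lam - jE ((u : Matrix (Fin 1) (Fin 1) E) 0 0)) / (jE ϖ * Θ (jE ϖ)) ^ b)) /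
        (θ₀ - ρ θ₀) * θ₀)
    (hbh : jE bh = ((lam - jE ((u : Matrix (Fin 1) (Fin 1) E) 0 0)) / (jE ϖ * Θ (jE ϖ)) ^ b -
      ρ ((lam - jE ((u : Matrix (Fin 1) (Fin 1) E) 0 0)) / (jE ϖ * Θ (jE ϖ)) ^ b)) / (θ₀ - ρ θ₀))
    {α₁ γ₁ : E}
    (haff : ∀ (T V f : E), σ T = T → Valued.v T = 1 → σ V = V → Valued.v V ≤ 1 → σ f = f → Valued.v (α₁ + γ₁ * V) = 1 →
      Valued.v (T * (â + bh * V) - f * ((ϖ - σ ϖ) * ((ϖ * σ ϖ) ^ ((d - d % 2) / 2))⁻¹)) ≤ Valued.v ϖ ^ mstarOfRecord d →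
      normSign σ f = normSign σ T * normSign σ (α₁ + γ₁ * V))
    (hunit : ∀ (T V : E), Valued.v T = 1 → Valued.v V ≤ 1 → Valued.v (α₁ + γ₁ * V) = 1 → Valued.v (T * (â + bh * V)) = 1)
    {Th Vh : E}
    (hTh : jE Th = (((α - ρ α) * Θ (α - ρ α)) * (h * (x₀ * Θ x₀)))⁻¹ + ρ (((α - ρ α) * Θ (α - ρ α)) * (h * (x₀ * Θ x₀)))⁻¹)
    (hVh : jE Vh = (θ₀ * (((α - ρ α) * Θ (α - ρ α)) * (h * (x₀ * Θ x₀)))⁻¹ + ρ (θ₀ * (((α - ρ α) * Θ (α - ρ α)) * (h * (x₀ * Θ x₀)))⁻¹)) /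
      ((((α - ρ α) * Θ (α - ρ α)) * (h * (x₀ * Θ x₀)))⁻¹ + ρ (((α - ρ α) * Θ (α - ρ α)) * (h * (x₀ * Θ x₀)))⁻¹))
    (hX : Valued.v (α₁ + γ₁ * Vh) = 1) :
    ({z : E | ∃ y ∈ L, Valued.v ((ϖ ^ mstarOfRecord d)⁻¹ * (z - pairing σ (!![H₂ 0 0, 0, H₂ 0 1; 0, hW, 0; H₂ 1 0, 0, H₂ 1 1] : Matrix (Fin 3) (Fin 3) E) y
        ((((endoGL (γ₂, u) : GL (Fin 3) E) : Matrix (Fin 3) (Fin 3) E) - 1) *ᵥ y))) ≤ 1} = valueSetMod σ ϖ (mstarOfRecord d) (xPlus σ ϖ d)) ↔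
      normSign σ Th * normSign σ (α₁ + γ₁ * Vh) = 1 := by
  obtain ⟨hσσ, hvσ, hϖ, -, -, hd1, -⟩ := id hD
  haveI := isAdicComplete_valuedInteger_of_completeSpace (K := E) hϖ
  -- letters
  have hϖM : Valued.v (jE ϖ) = exp (-1 : ℤ) := by rw [hjiso, hϖ]
  have hvϖ0 : Valued.v (jE ϖ) ≠ 0 := by rw [hϖM]; exact exp_ne_zero
  have hjϖ0 : jE ϖ ≠ 0 := fun h0 => by rw [h0, map_zero] at hvϖ0; exact hvϖ0 rfl
  have hϖ1 : Valued.v (jE ϖ) ≤ 1 := by rw [hϖM, ← exp_zero, exp_le_exp]; norm_num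
  have hϖ1E : Valued.v ϖ ≤ 1 := by rw [← hjiso]; exact hϖ1
  have hρϖ : ρ (jE ϖ) = jE ϖ := (hjfix _).2 ⟨ϖ, rfl⟩
  have hα0 : α - ρ α ≠ 0 := fun h0 => by rw [h0, map_zero] at hU; exact zero_ne_one hU
  have hc : ρ (jE ϖ ^ b) = jE ϖ ^ b := by rw [map_pow, hρϖ]
  have hc0 : jE ϖ ^ b ≠ 0 := pow_ne_zero _ hjϖ0
  have hc1 : Valued.v (jE ϖ ^ b) ≤ 1 := by rw [Valuation.map_pow]; exact pow_le_one₀ zero_le hϖ1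
  have hcc : jE ϖ ^ b * (α - ρ α) ≠ 0 := mul_ne_zero hc0 hα0
  have hθ₀ : ρ θ₀ ≠ θ₀ := fun h0 => by rw [h0, sub_self, map_zero] at hθρ; exact zero_ne_one hθρ
  set μ : M := lam - jE ((u : Matrix (Fin 1) (Fin 1) E) 0 0) with hμdef
  -- the coordinates of the generator (★ K5c)
  obtain ⟨-, -, -, hTv, hρT, hΘT, hρV, hΘV, hV1, hfact⟩ :=
    coords_letters_of_gen hρρ hvρ hΘΘ hΘρ hvΘ hU hram hΘh hρϖ hϖM hΘθ₀ hθ1 hθρ hb1 hYprim hYv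
  set T : M := (((α - ρ α) * Θ (α - ρ α)) * (h * (x₀ * Θ x₀)))⁻¹ + ρ (((α - ρ α) * Θ (α - ρ α)) * (h * (x₀ * Θ x₀)))⁻¹ with hTdef
  set W : M := θ₀ * (((α - ρ α) * Θ (α - ρ α)) * (h * (x₀ * Θ x₀)))⁻¹ + ρ (θ₀ * (((α - ρ α) * Θ (α - ρ α)) * (h * (x₀ * Θ x₀)))⁻¹) with hWdef
  have hT0 : T ≠ 0 := fun h0 => by rw [h0, map_zero] at hTv; exact zero_ne_one hTv
  have hWTV : W = T * (W / T) := by rw [mul_div_cancel₀ _ hT0]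
  -- `E`-side letters of `T̂`, `V̂`
  have hσTh : σ Th = Th := jE.injective (by rw [← hΘj, hTh, hΘT])
  have hTh1 : Valued.v Th = 1 := by rw [← hjiso, hTh, hTv]
  have hσVh : σ Vh = Vh := jE.injective (by rw [← hΘj, hVh, hΘV])
  have hVh1 : Valued.v Vh ≤ 1 := by rw [← hjiso, hVh]; exact hV1
  -- the ray scalar `e₀ = T̂·(â + b̂V̂)` and `jE e₀ = Tr_ρ(μ∕D₀)` (★ K3)
  set e₀ : E := Th * (â + bh * Vh) with he₀def
  have he₀ : jE e₀ = μ / (jE ϖ ^ b * (α - ρ α) * Θ (dualGen ρ Θ α (jE ϖ ^ b) h x₀)) +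
      ρ (μ / (jE ϖ ^ b * (α - ρ α) * Θ (dualGen ρ Θ α (jE ϖ ^ b) h x₀))) := by
    rw [trace_scalar_eq_coords (ρ := ρ) (μ := μ) (b := b) hρρ hΘΘ hΘh hh hx₀ hα0 hjϖ0 hθ₀, he₀def, map_mul, map_add, map_mul, hTh, hâ, hbh, hVh,
      ← hTdef, ← hWdef]
    field_simp
  have he₀v : Valued.v e₀ = Valued.v ϖ ^ (d % 2) := by
    rw [hd0, pow_zero, he₀def]; exact hunit Th Vh hTh1 hVh1 hX
  -- ray domination and the skew token (§1), the population token (★ DEFS), `Tr_ρ`-identity `lam − ρlam = μ − ρμ`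
  have hlamμ : lam - ρ lam = μ - ρ μ := by rw [hμdef, map_sub, (hjfix _).2 ⟨_, rfl⟩]; ring
  have hjl0 : Valued.v (μ - ρ μ) = Valued.v (jE ϖ) ^ (2 * b + 2 * 0) := by rw [mul_zero, add_zero]; exact hjl
  obtain ⟨⟨hμeq, hμt⟩, hsk⟩ := v_hatmu_letters_of_row hU jE hjfix hϖM (lam := lam) (k := mstarOfRecord d) (n := n) hm hjl0 hlamμ hYv hmb
    (by rw [mul_zero, add_zero]; exact hmg) (by rw [mul_zero, add_zero]; exact hn')
  have hP : IsOrd ρ α (jE ϖ ^ b) (μ / dualGen ρ Θ α (jE ϖ ^ b) h x₀) :=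
    (forall_herm_mul_mem_iff_isOrd_div hρρ hvρ hα hα1 hintρ hΘΘ hΘρ hvΘ hc hc0 hc1 hh hx₀ hΛx μ).1 hdep
  -- ★ p863048: the vertex is labelled by a `σ`-fixed unit `e′` near `e₀∕t₊`
  obtain ⟨e', hσe', he'1, hclose, hVS⟩ := exists_fixed_unit_valueSet_endoGL_sub_one_glued_eq_smul_xPlus hD H₂ hW jE hjv hjfix hρρ hvρ hα hα1 hintρ
    hΘΘ hΘρ hvΘ hΘj φ hφs hφγ hh hΘh hform hpr hintL hB hg₀ hg₀1 hprg u hc hc0 hc1 hcc hx₀ hBΛ hΛx hw₀Y hYO hμeq hμt le_rfl hΘlam hvlam huu hP he₀ he₀v hn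
    hlamn hun hsk
  -- ★ K4's sign property at `(T̂, V̂, e′)`
  have hsign : normSign σ e' = normSign σ Th * normSign σ (α₁ + γ₁ * Vh) := haff Th Vh e' hσTh hTh1 hσVh hVh1 hσe' hX hclose
  -- conclude through ★ `labelPlus_smul_xPlus_iff_exists_norm`
  rw [hVS, ← hsign]
  have key := labelPlus_smul_xPlus_iff_exists_norm hD hσe' he'1
  rw [LabelPlus, show d % 2 + 2 * d - 1 = mstarOfRecord d from rfl] at key
  rw [key]
  constructor
  · intro hN; exact normSign_of_isNorm σ hN
  · intro h1
    by_contra hN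
    rw [normSign_of_not_isNorm σ hN] at h1
    norm_num at h1

/-! ## §2 On the X-digit the vertex is not labelled `+` -/

/-- **«AT δ = 0, ON THE X-DIGIT, A GLUED VERTEX OVER `Λ = x₀·𝒪_b` IS NOT LABELLED `+`».**  Sub-frame of §1 (no ray domination, no deep tokens: `|u₀₀ − 1| ≤ |ϖ^{m*}|`, `d ≤ b`,
the RamK datum on `M` for the trace letter) with `hdrop` (★ D0-1 (b)) and `hX : |α₁ + γ₁V̂| < 1`.  THEN `VS_{m*}(Γ − 1 ∣ L) ≠ valueSetMod σ ϖ m* X₊`: by the gap-free ★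
`valueSet_endoGL_sub_one_glued_eq_scalar_normSet_of_diag` the value set is `thick_{m*}{e₀·N(a)}` with `|e₀| < 1`, which misses `t₊ ∈ valueSetMod σ ϖ m* X₊` (`|t₊| = 1`, `m* ≥ 1`).
[cite: Jacobowitz1962, §4] [cite: Rogawski1990, §4.9 Prop. 4.9.1 (b) p. 55] [cite: Serre1979, Ch. III §3 Prop. 7; Ch. V §3 Cor. 3] -/
theorem valueSet_ne_xPlus_of_xDigit_of_gap_zero [CompleteSpace E] {σ : E →+* E} {ϖ : E} {d t : ℕ} (hD : IsRamifiedQuadraticDatum σ ϖ d t) (hd0 : d % 2 = 0)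
    (H₂ : Matrix (Fin 2) (Fin 2) E) (hW : E)
    (jE : E →+* M) (hjv : ∀ c, Valued.v (jE c) ≤ 1 ↔ Valued.v c ≤ 1) (hjfix : ∀ z, ρ z = z ↔ ∃ c, jE c = z) (hjiso : ∀ a, Valued.v (jE a) = Valued.v a)
    (hρρ : ∀ x, ρ (ρ x) = x) (hvρ : ∀ x, Valued.v (ρ x) = Valued.v x)
    (hΘΘ : ∀ x, Θ (Θ x) = x) (hΘρ : ∀ x, Θ (ρ x) = ρ (Θ x)) (hvΘ : ∀ x, Valued.v (Θ x) = Valued.v x) (hΘj : ∀ c, Θ (jE c) = jE (σ c))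
    (hU : Valued.v (α - ρ α) = 1) (hram : Valued.v (α - Θ α) < 1)
    (φ : (Fin 2 → E) →+ M) (hφs : ∀ (c : E) (x : Fin 2 → E), φ (c • x) = jE c * φ x)
    {γ₂ : GL (Fin 2) E} {lam h : M} (hφγ : ∀ x, φ ((γ₂ : Matrix (Fin 2) (Fin 2) E) *ᵥ x) = lam * φ x) (hh : h ≠ 0) (hΘh : Θ h = h)
    (hform : ∀ x y, jE (pairing σ H₂ x y) = h * Θ (φ x) * φ y + ρ (h * Θ (φ x) * φ y))
    {L : Submodule 𝒪[E] (Fin 3 → E)} {b : ℕ} (hpr : ∀ x ∈ L, Valued.v (x 1) * Valued.v ϖ ^ b ≤ 1)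
    (hintL : ∀ y ∈ L, Valued.v (pairing σ (!![H₂ 0 0, 0, H₂ 0 1; 0, hW, 0; H₂ 1 0, 0, H₂ 1 1] : Matrix (Fin 3) (Fin 3) E) y y) ≤ 1)
    {B₂ : Submodule 𝒪[E] (Fin 2 → E)} {w₀ : Fin 2 → E} {g₀ : Fin 3 → E}
    (hB : B₂.map ((Matrix.toLin' (!![1, 0; 0, 0; 0, 1] : Matrix (Fin 3) (Fin 2) E)).restrictScalars 𝒪[E]) =
      L ⊓ LinearMap.ker ((LinearMap.proj (1 : Fin 3) : (Fin 3 → E) →ₗ[E] E).restrictScalars 𝒪[E]))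
    (hg₀ : g₀ ∈ L) (hg₀1 : Valued.v (g₀ 1) * Valued.v ϖ ^ b = 1) (hprg : g₀ - Pi.single 1 (g₀ 1) = ![w₀ 0, 0, w₀ 1])
    (u : GL (Fin 1) E) {x₀ : M} (hx₀ : x₀ ≠ 0) {Λ : AddSubgroup M} (hBΛ : B₂.toAddSubgroup.map φ = Λ)
    (hΛx : ∀ x, x ∈ Λ ↔ ∃ ζ, IsOrd ρ α (jE ϖ ^ b) ζ ∧ x = x₀ * ζ) (hw₀Y : φ w₀ = (dualGen ρ Θ α (jE ϖ ^ b) h x₀)⁻¹ * x₀)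
    (hYprim : ¬ IsOrd ρ α (jE ϖ ^ b) (dualGen ρ Θ α (jE ϖ ^ b) h x₀ / jE ϖ))
    (hYv : Valued.v (dualGen ρ Θ α (jE ϖ ^ b) h x₀) = Valued.v (jE ϖ) ^ b)
    (hb1 : 1 ≤ b) (hmb : mstarOfRecord d ≤ 2 * b) (hdb : d ≤ b)
    (hm : Valued.v (lam - jE ((u : Matrix (Fin 1) (Fin 1) E) 0 0)) = Valued.v (jE ϖ) ^ (2 * b))
    (hum : Valued.v ((u : Matrix (Fin 1) (Fin 1) E) 0 0 - 1) ≤ Valued.v (ϖ ^ mstarOfRecord d))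
    -- the pivot, the coordinates of `μ̂`, the X-digit clause of the affine letters, the preimages of `T(x₀)`, `V(x₀)`, the RamK datum on `M`
    {θ₀ : M} (hΘθ₀ : Θ θ₀ = θ₀) (hθ1 : Valued.v θ₀ ≤ 1) (hθρ : Valued.v (θ₀ - ρ θ₀) = 1)
    {â bh : E}
    (hâ : jE â = (lam - jE ((u : Matrix (Fin 1) (Fin 1) E) 0 0)) / (jE ϖ * Θ (jE ϖ)) ^ b -
      ((lam - jE ((u : Matrix (Fin 1) (Fin 1) E) 0 0)) / (jE ϖ * Θ (jE ϖ)) ^ b - ρ ((lam - jE ((u : Matrix (Fin 1) (Fin 1) E) 0 0)) / (jE ϖ * Θ (jE ϖ)) ^ b)) /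
        (θ₀ - ρ θ₀) * θ₀)
    (hbh : jE bh = ((lam - jE ((u : Matrix (Fin 1) (Fin 1) E) 0 0)) / (jE ϖ * Θ (jE ϖ)) ^ b -
      ρ ((lam - jE ((u : Matrix (Fin 1) (Fin 1) E) 0 0)) / (jE ϖ * Θ (jE ϖ)) ^ b)) / (θ₀ - ρ θ₀))
    {α₁ γ₁ : E}
    (hdrop : ∀ (T V : E), σ T = T → Valued.v T = 1 → σ V = V → Valued.v V ≤ 1 → Valued.v (α₁ + γ₁ * V) < 1 → Valued.v (T * (â + bh * V)) < 1)
    {Th Vh : E}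
    (hTh : jE Th = (((α - ρ α) * Θ (α - ρ α)) * (h * (x₀ * Θ x₀)))⁻¹ + ρ (((α - ρ α) * Θ (α - ρ α)) * (h * (x₀ * Θ x₀)))⁻¹)
    (hVh : jE Vh = (θ₀ * (((α - ρ α) * Θ (α - ρ α)) * (h * (x₀ * Θ x₀)))⁻¹ + ρ (θ₀ * (((α - ρ α) * Θ (α - ρ α)) * (h * (x₀ * Θ x₀)))⁻¹)) /
      ((((α - ρ α) * Θ (α - ρ α)) * (h * (x₀ * Θ x₀)))⁻¹ + ρ (((α - ρ α) * Θ (α - ρ α)) * (h * (x₀ * Θ x₀)))⁻¹))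
    {tM : ℕ} (hDM : IsRamifiedQuadraticDatum Θ (jE ϖ) d tM) (hX : Valued.v (α₁ + γ₁ * Vh) < 1) :
    {z : E | ∃ y ∈ L, Valued.v ((ϖ ^ mstarOfRecord d)⁻¹ * (z - pairing σ (!![H₂ 0 0, 0, H₂ 0 1; 0, hW, 0; H₂ 1 0, 0, H₂ 1 1] : Matrix (Fin 3) (Fin 3) E) y
        ((((endoGL (γ₂, u) : GL (Fin 3) E) : Matrix (Fin 3) (Fin 3) E) - 1) *ᵥ y))) ≤ 1} ≠ valueSetMod σ ϖ (mstarOfRecord d) (xPlus σ ϖ d) := by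
  obtain ⟨hσσ, hvσ, hϖ, -, -, hd1, -⟩ := id hD
  -- letters
  have hϖM : Valued.v (jE ϖ) = exp (-1 : ℤ) := by rw [hjiso, hϖ]
  have hvϖ0 : Valued.v (jE ϖ) ≠ 0 := by rw [hϖM]; exact exp_ne_zero
  have hjϖ0 : jE ϖ ≠ 0 := fun h0 => by rw [h0, map_zero] at hvϖ0; exact hvϖ0 rfl
  have hϖ0 : ϖ ≠ 0 := fun h0 => hjϖ0 (by rw [h0, map_zero])
  have hϖlt : Valued.v ϖ < 1 := by rw [hϖ, ← exp_zero, exp_lt_exp]; norm_num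
  have hρϖ : ρ (jE ϖ) = jE ϖ := (hjfix _).2 ⟨ϖ, rfl⟩
  have hρj : ∀ c : E, ρ (jE c) = jE c := fun c => (hjfix _).2 ⟨c, rfl⟩
  have hα0 : α - ρ α ≠ 0 := fun h0 => by rw [h0, map_zero] at hU; exact zero_ne_one hU
  have hc0 : jE ϖ ^ b ≠ 0 := pow_ne_zero _ hjϖ0
  have hcc : jE ϖ ^ b * (α - ρ α) ≠ 0 := mul_ne_zero hc0 hα0
  have hθ₀ : ρ θ₀ ≠ θ₀ := fun h0 => by rw [h0, sub_self, map_zero] at hθρ; exact zero_ne_one hθρ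
  set μ : M := lam - jE ((u : Matrix (Fin 1) (Fin 1) E) 0 0) with hμdef
  -- the coordinates of the generator (★ K5c)
  obtain ⟨-, -, -, hTv, -, hΘT, -, hΘV, hV1, -⟩ :=
    coords_letters_of_gen hρρ hvρ hΘΘ hΘρ hvΘ hU hram hΘh hρϖ hϖM hΘθ₀ hθ1 hθρ hb1 hYprim hYv
  set T : M := (((α - ρ α) * Θ (α - ρ α)) * (h * (x₀ * Θ x₀)))⁻¹ + ρ (((α - ρ α) * Θ (α - ρ α)) * (h * (x₀ * Θ x₀)))⁻¹ with hTdef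
  set W : M := θ₀ * (((α - ρ α) * Θ (α - ρ α)) * (h * (x₀ * Θ x₀)))⁻¹ + ρ (θ₀ * (((α - ρ α) * Θ (α - ρ α)) * (h * (x₀ * Θ x₀)))⁻¹) with hWdef
  have hT0 : T ≠ 0 := fun h0 => by rw [h0, map_zero] at hTv; exact zero_ne_one hTv
  -- `E`-side letters of `T̂`, `V̂`
  have hσTh : σ Th = Th := jE.injective (by rw [← hΘj, hTh, hΘT])
  have hTh1 : Valued.v Th = 1 := by rw [← hjiso, hTh, hTv]
  have hσVh : σ Vh = Vh := jE.injective (by rw [← hΘj, hVh, hΘV])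
  have hVh1 : Valued.v Vh ≤ 1 := by rw [← hjiso, hVh]; exact hV1
  -- the scalar `e₀ = T̂·(â + b̂V̂)`, `jE e₀ = Tr_ρ(μ∕D₀)` (★ K3), NOT a unit on the X-digit
  set e₀ : E := Th * (â + bh * Vh) with he₀def
  have he₀ : jE e₀ = μ / (jE ϖ ^ b * (α - ρ α) * Θ (dualGen ρ Θ α (jE ϖ ^ b) h x₀)) +
      ρ (μ / (jE ϖ ^ b * (α - ρ α) * Θ (dualGen ρ Θ α (jE ϖ ^ b) h x₀))) := by
    rw [trace_scalar_eq_coords (ρ := ρ) (μ := μ) (b := b) hρρ hΘΘ hΘh hh hx₀ hα0 hjϖ0 hθ₀, he₀def, map_mul, map_add, map_mul, hTh, hâ, hbh, hVh,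
      ← hTdef, ← hWdef]
    field_simp
  have he₀lt : Valued.v e₀ < 1 := hdrop Th Vh hσTh hTh1 hσVh hVh1 hX
  -- the value set of the vertex is the thickened scalar norm set (★ `…LetterBalanced` §2, gap-free)
  have hccv : Valued.v (jE ϖ ^ b * (α - ρ α)) = Valued.v (jE ϖ) ^ b := by rw [Valuation.map_mul, Valuation.map_pow, hU, mul_one]
  have htrace : ∀ w : M, Valued.v w ≤ Valued.v (jE ϖ) ^ b → Valued.v (w + Θ w) ≤ Valued.v (jE ϖ) ^ mstarOfRecord d :=
    fun w hw => v_add_map_le_varpi_pow_mstar_of_datum hDM hdb hw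
  rw [valueSet_endoGL_sub_one_glued_eq_scalar_normSet_of_diag σ hϖ H₂ hW jE hjv hρj hvρ hΘΘ hvΘ hΘj φ hφs hφγ hh hform hpr hintL hB hg₀ hg₀1 hprg u
    (mstarOfRecord d) hum hcc hx₀ hBΛ hΛx hw₀Y hYv hccv hmb htrace hm.le e₀ he₀]
  intro hEq
  -- `t₊ ∈ valueSetMod σ ϖ m* X₊` (`a = 1`), but `t₊` is not within `ϖ^{m*}` of `e₀·N(a)`: `|e₀·aσa| < 1 = |t₊|`, `m* ≥ 1`
  obtain ⟨-, hvt⟩ := refSkew_map_and_v hD hd0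
  set tp : E := (ϖ - σ ϖ) * ((ϖ * σ ϖ) ^ ((d - d % 2) / 2))⁻¹ with htp
  have ht : tp ∈ valueSetMod σ ϖ (mstarOfRecord d) (xPlus σ ϖ d) := by
    rw [← one_smul E (xPlus σ ϖ d), valueSetMod_smul_xPlus]
    exact ⟨1, by rw [map_one], by simp [← htp]⟩
  rw [← hEq] at ht
  obtain ⟨a, ha, hle⟩ := ht
  have hlt : Valued.v (e₀ * (a * σ a)) < Valued.v tp := by
    rw [hvt, Valuation.map_mul _ e₀, Valuation.map_mul _ a (σ a), hvσ]
    calc Valued.v e₀ * (Valued.v a * Valued.v a) ≤ Valued.v e₀ * (1 * 1) := by gcongr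
      _ < 1 := by rw [mul_one, mul_one]; exact he₀lt
  have h1 : Valued.v (tp - e₀ * (a * σ a)) = 1 := by rw [Valuation.map_sub_eq_of_lt_left _ hlt, hvt]
  have hpow0 : Valued.v (ϖ ^ mstarOfRecord d) ≠ 0 := by rw [Valuation.map_pow]; exact pow_ne_zero _ (by rw [hϖ]; exact exp_ne_zero)
  have h2 : (1 : ℤᵐ⁰) ≤ Valued.v (ϖ ^ mstarOfRecord d) := by
    have h3 := mul_le_mul_left hle (Valued.v (ϖ ^ mstarOfRecord d))
    rwa [one_mul, Valuation.map_mul, map_inv₀, h1, mul_one, inv_mul_cancel₀ hpow0] at h3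
  have h4 : Valued.v (ϖ ^ mstarOfRecord d) < 1 := by
    rw [Valuation.map_pow]; exact pow_lt_one₀ zero_le hϖlt (by simp only [mstarOfRecord]; omega)
  exact absurd h2 (not_le.2 h4)

end Summit.HodgeConjecture.HodgeConjecture.Cruxes.H413.F0P3cDyRamDiagonalCellVertexReadDeltaZero

end
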